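import Literature.NumberTheory.Rogawski1990.UnitStableOrbitalIntegralHSideValue           -- ★ p840855 (L5)∕(F9) FINAL (B-p10)
import Literature.NumberTheory.Automorphic.UnitaryEllipticCentralizerCompactNonsplit      -- ★ p840972 (E4) compact centralisers (B-p10)
import Literature.NumberTheory.Automorphic.RankTwoEigenframeOfSplitCharpoly               -- ★ p840948 (E1) eigenframe from a root (A-p13)
import Literature.NumberTheory.Rogawski1990.LocalHyperbolicClassIsLevi                    -- ★ p841023 (E3) norm-one eigenvalues from `hell` (A-p13)
import Literature.NumberTheory.Automorphic.LocalEndoscopicOrbitClosed                     -- ★ `isGRegular_of_isStablyConjH`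
import Literature.NumberTheory.Rogawski1990.LocalCentralizerTorusMeasureCM                -- ★ `isRegularElt_fst_snd_of_isLocalGRegular`
import HarnessLib

/-!
# (S1-bis) The H-side value IN THE STUB FRAME of `stub_countSplitClause` («N7nsCount», Flicker 1998 §6 p. 95)

Topic `NumberTheory/Rogawski1990`; namespace `Literature.NumberTheory.Automorphic.UnitaryGroup`.  THEOREMS ONLY (no definition, no instance, no notation, no named
fact, no `sorry`).  Cell `pub/hodgecm-mathlib`, F0∕P3a road «D-N7-inert» ∕ MAP v3 (F9)+(F12): the (S1) H-SIDE PAYER of A-p06 (g26)'s assembly contract SPEC-F12 in the frame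
of the registered stub `Cruxes/H413/Lines/F0_P3a_N7nsCount.lean :183 stub_countSplitClause` (B-p10 (g24), integrator; architect A-p06 04:21:44Z (1)).  HC_CM is proved only
modulo the printed citations until rung 0 closes; this file is unconditional: ★ p840855 FINAL value with its frame data DISCHARGED — the eigenframe from a root of `χ_{γ₂,w}` and
`G`-regularity (★ (E1) p840948, A-p13), norm-one eigenvalues from ellipticity (★ (E3), A-p13), compact centralisers of BOTH classes (★ (E4) p840972), `G`-regularity of the
second class (★ `isGRegular_of_isStablyConjH`), and `N` read from `v_w(α − γ) = N` (★ `v_eq_iff_valuation_eq`).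

* **`stableOrbitalIntegralRel_indicator_eq_phiH_of_isRoot`** — binders of `stub_countSplitClause` (those the value needs: `w hw hv`, `νH`, `mH hmH hνH`, `γH hreg hell`) +
  A-p13's root∕exponent hypotheses `(α γ : L_w) (hα hγ : IsRoot (χ_{γH.1}.map ev_w) ·) (hαγ : α ≠ γ) (N) (hN : Valued.v (α − γ) = exp (−N))` ⊢
  `stableOrbitalIntegralRel (IsLocalStablyConjH L v) mH 1_{K₂ ×ˢ K₁} γH = ((Flicker1998.phiH (Ideal.absNorm v.asIdeal) N : ℚ) : ℂ)`.

## References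
* [Flicker1998UnitaryFL] Y. Z. Flicker, *Elementary proof of the fundamental lemma for a unitary group*, Canad. J. Math. 50 (1998), §6 p. 95.
* [Rogawski1990] J. D. Rogawski, *Automorphic Representations of Unitary Groups in Three Variables* (1990), §4.9 Prop. 4.9.1 (b) p. 55; §3.6 p. 31.
-/

set_option autoImplicit false

noncomputable section

open MeasureTheory NumberField IsDedekindDomain Matrix Polynomial ValuativeRel
open scoped ValuativeRel Matrix MatrixGroups

namespace Literature.NumberTheory.Automorphic.UnitaryGroup

open Literature.NumberTheory.Rogawski1990

variable (L : Type) [Field L] [NumberField L] [IsCMField L] (v : HeightOneSpectrum (𝓞 ↥(maximalRealSubfield L)))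
  (w : PlacesOver L v) (hw : IsCMField.complexConj L • w.1 = w.1)

/-! ## §1 Roots and eigenvalues at `w` -/

omit [IsCMField L] in
/-- **The eigenvalues read at `w` are the two roots of `χ_{γ,w}`**: for an eigenframe `γ P = P diag(u)` over `E_v`, `χ_γ.map ev_w = (X − u₀(w))(X − u₁(w))`; so a root
`β` of it is `u₀(w)` or `u₁(w)`. [cite: Rogawski1990, §3.6 p. 31] -/
theorem eq_or_eq_eval_of_isRoot_of_eigenframe {γ P : GL (Fin 2) (LocalRing L v)} {u : Fin 2 → LocalRing L v}
    (hP : γ.val * P.val = P.val * diagonal u) {β : w.1.adicCompletion L}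
    (hβ : ((γ.val.charpoly).map (Pi.evalRingHom (fun w' : PlacesOver L v => w'.1.adicCompletion L) w)).IsRoot β) : β = u 0 w ∨ β = u 1 w := by
  -- `χ_γ = χ_{diag u} = (X − C u₀)(X − C u₁)`
  have hconj : (P⁻¹).val * γ.val * P.val = diagonal u := by
    rw [Matrix.mul_assoc, hP, ← Matrix.mul_assoc, Units.inv_mul, Matrix.one_mul]
  have hchar : γ.val.charpoly = ∏ i : Fin 2, (X - C (u i)) := by
    rw [← Matrix.charpoly_units_conj' P γ.val, ← Matrix.coe_units_inv, hconj, Matrix.charpoly_diagonal]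
  rw [hchar, Polynomial.map_prod, Fin.prod_univ_two] at hβ
  simp only [Polynomial.map_sub, Polynomial.map_X, Polynomial.map_C, Pi.evalRingHom_apply] at hβ
  rcases Polynomial.root_mul.1 hβ with h | h
  · exact Or.inl (Polynomial.root_X_sub_C.1 h).symm
  · exact Or.inr (Polynomial.root_X_sub_C.1 h).symm

/-! ## §2 The stub-frame head -/

section Head

variable
  [MeasurableSpace ((cmDatum L 2 (Matrix.of fun i j : Fin 2 => if i.val + j.val + 1 = 2 then (1 : L) else 0)).Local v × (cmDatum L 1 (Matrix.of fun i j : Fin 1 => if i.val + j.val + 1 = 1 then (1 : L) else 0)).Local v)] [BorelSpace ((cmDatum L 2 (Matrix.of fun i j : Fin 2 => if i.val + j.val + 1 = 2 then (1 : L) else 0)).Local v × (cmDatum L 1 (Matrix.of fun i j : Fin 1 => if i.val + j.val + 1 = 1 then (1 : L) else 0)).Local v)]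
  [∀ a : (cmDatum L 2 (Matrix.of fun i j : Fin 2 => if i.val + j.val + 1 = 2 then (1 : L) else 0)).Local v × (cmDatum L 1 (Matrix.of fun i j : Fin 1 => if i.val + j.val + 1 = 1 then (1 : L) else 0)).Local v, MeasurableSpace (((cmDatum L 2 (Matrix.of fun i j : Fin 2 => if i.val + j.val + 1 = 2 then (1 : L) else 0)).Local v × (cmDatum L 1 (Matrix.of fun i j : Fin 1 => if i.val + j.val + 1 = 1 then (1 : L) else 0)).Local v) ⧸ Subgroup.centralizer ({a} : Set ((cmDatum L 2 (Matrix.of fun i j : Fin 2 => if i.val + j.val + 1 = 2 then (1 : L) else 0)).Local v × (cmDatum L 1 (Matrix.of fun i j : Fin 1 => if i.val + j.val + 1 = 1 then (1 : L) else 0)).Local v)))]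
  [∀ a : (cmDatum L 2 (Matrix.of fun i j : Fin 2 => if i.val + j.val + 1 = 2 then (1 : L) else 0)).Local v × (cmDatum L 1 (Matrix.of fun i j : Fin 1 => if i.val + j.val + 1 = 1 then (1 : L) else 0)).Local v, BorelSpace (((cmDatum L 2 (Matrix.of fun i j : Fin 2 => if i.val + j.val + 1 = 2 then (1 : L) else 0)).Local v × (cmDatum L 1 (Matrix.of fun i j : Fin 1 => if i.val + j.val + 1 = 1 then (1 : L) else 0)).Local v) ⧸ Subgroup.centralizer ({a} : Set ((cmDatum L 2 (Matrix.of fun i j : Fin 2 => if i.val + j.val + 1 = 2 then (1 : L) else 0)).Local v × (cmDatum L 1 (Matrix.of fun i j : Fin 1 => if i.val + j.val + 1 = 1 then (1 : L) else 0)).Local v)))]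
  (νH : Measure ((cmDatum L 2 (Matrix.of fun i j : Fin 2 => if i.val + j.val + 1 = 2 then (1 : L) else 0)).Local v × (cmDatum L 1 (Matrix.of fun i j : Fin 1 => if i.val + j.val + 1 = 1 then (1 : L) else 0)).Local v)) [νH.IsHaarMeasure] [νH.IsMulRightInvariant]

set_option maxHeartbeats 400000 in
include hw in
/-- **(S1) OF SPEC-F12 IN THE STUB FRAME — `Φ^st(γ_H, 1_{K_H}) = phiH q N` for `stub_countSplitClause`.**  Binders: the stub's `w hw hv νH mH hmH hνH γH hreg hell` (those the
value needs) + A-p13's root∕exponent hypotheses `α γ hα hγ hαγ N hN` (the two roots of `χ_{γH.1,w}` in `L_w`, `N = v_w(α − γ)`).  All frame data of ★ p840855 are discharged here: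
eigenframe ★ (E1), norm-one eigenvalues ★ (E3) (from `hell`), compact centralisers of both classes ★ (E4), `G`-regularity of the second class ★ `isGRegular_of_isStablyConjH`.
[cite: Flicker1998UnitaryFL, §6 p. 95] [cite: Rogawski1990, §4.9 Prop. 4.9.1 (b) p. 55] -/
theorem stableOrbitalIntegralRel_indicator_eq_phiH_of_isRoot (hv : Algebra.IsUnramifiedIn (𝓞 L) v.asIdeal)
    {mH : OrbitalMeasureFamily ((cmDatum L 2 (Matrix.of fun i j : Fin 2 => if i.val + j.val + 1 = 2 then (1 : L) else 0)).Local v × (cmDatum L 1 (Matrix.of fun i j : Fin 1 => if i.val + j.val + 1 = 1 then (1 : L) else 0)).Local v)} (hmH : mH.IsCanonical (IsLocalGRegular L v) νH)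
    (hνH : νH ((((cmLocalIntegralLevel L 2 (Matrix.of fun i j : Fin 2 => if i.val + j.val + 1 = 2 then (1 : L) else 0) v).prod (cmLocalIntegralLevel L 1 (Matrix.of fun i j : Fin 1 => if i.val + j.val + 1 = 1 then (1 : L) else 0) v)) : Subgroup ((cmDatum L 2 (Matrix.of fun i j : Fin 2 => if i.val + j.val + 1 = 2 then (1 : L) else 0)).Local v × (cmDatum L 1 (Matrix.of fun i j : Fin 1 => if i.val + j.val + 1 = 1 then (1 : L) else 0)).Local v)) : Set ((cmDatum L 2 (Matrix.of fun i j : Fin 2 => if i.val + j.val + 1 = 2 then (1 : L) else 0)).Local v × (cmDatum L 1 (Matrix.of fun i j : Fin 1 => if i.val + j.val + 1 = 1 then (1 : L) else 0)).Local v)) = 1)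
    {γH : (cmDatum L 2 (Matrix.of fun i j : Fin 2 => if i.val + j.val + 1 = 2 then (1 : L) else 0)).Local v × (cmDatum L 1 (Matrix.of fun i j : Fin 1 => if i.val + j.val + 1 = 1 then (1 : L) else 0)).Local v} (hreg : IsLocalGRegular L v γH)
    (hell : ¬ ∃ (y : ((cmDatum L 2 (Matrix.of fun i j : Fin 2 => if i.val + j.val + 1 = 2 then (1 : L) else 0)).Local v × (cmDatum L 1 (Matrix.of fun i j : Fin 1 => if i.val + j.val + 1 = 1 then (1 : L) else 0)).Local v)) (d' : Fin 2 → (UnitaryGroup.LocalRing L v)ˣ),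
        glDiagonal 2 (UnitaryGroup.LocalRing L v) d' = ((y * γH * y⁻¹).1.val : GL (Fin 2) (UnitaryGroup.LocalRing L v)))
    (α γ : w.1.adicCompletion L)
    (hα : ((((γH.1.val : GL (Fin 2) (LocalRing L v)) : Matrix (Fin 2) (Fin 2) (LocalRing L v)).charpoly).map (Pi.evalRingHom (fun w' : PlacesOver L v => w'.1.adicCompletion L) w)).IsRoot α)
    (hγ : ((((γH.1.val : GL (Fin 2) (LocalRing L v)) : Matrix (Fin 2) (Fin 2) (LocalRing L v)).charpoly).map (Pi.evalRingHom (fun w' : PlacesOver L v => w'.1.adicCompletion L) w)).IsRoot γ)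
    (hαγ : α ≠ γ) (N : ℕ) (hN : Valued.v (α - γ) = WithZero.exp (-(N : ℤ))) :
    stableOrbitalIntegralRel (IsLocalStablyConjH L v) mH (((((cmLocalIntegralLevel L 2 (Matrix.of fun i j : Fin 2 => if i.val + j.val + 1 = 2 then (1 : L) else 0) v).prod (cmLocalIntegralLevel L 1 (Matrix.of fun i j : Fin 1 => if i.val + j.val + 1 = 1 then (1 : L) else 0) v)) : Subgroup ((cmDatum L 2 (Matrix.of fun i j : Fin 2 => if i.val + j.val + 1 = 2 then (1 : L) else 0)).Local v × (cmDatum L 1 (Matrix.of fun i j : Fin 1 => if i.val + j.val + 1 = 1 then (1 : L) else 0)).Local v)) : Set ((cmDatum L 2 (Matrix.of fun i j : Fin 2 => if i.val + j.val + 1 = 2 then (1 : L) else 0)).Local v × (cmDatum L 1 (Matrix.of fun i j : Fin 1 => if i.val + j.val + 1 = 1 then (1 : L) else 0)).Local v)).indicator fun _ => (1 : ℂ)) γH =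
      ((Flicker1998.phiH (Ideal.absNorm v.asIdeal) N : ℚ) : ℂ) := by
  have hc1 : IsCMField.complexConj L ≠ 1 := IsCMField.complexConj_ne_one L
  -- (E1) the eigenframe over `E_v`, `u₀(w) = α`
  have hsep : (((γH.1.val : GL (Fin 2) (LocalRing L v)) : Matrix (Fin 2) (Fin 2) (LocalRing L v)).charpoly).Separable :=
    (isRegularElt_fst_snd_of_isLocalGRegular L v γH hreg).1
  obtain ⟨P, u, hP, hu, hu0⟩ := exists_eigenframe_cmDatum_local_of_isRoot_map_of_separable L v w hw γH.1 hα hsep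
  -- the second eigenvalue at `w` is `γ`
  have hu1w : u 1 w = γ := by
    rcases eq_or_eq_eval_of_isRoot_of_eigenframe L v w hP hγ with h | h
    · exact absurd (h.trans hu0) (Ne.symm hαγ)
    · exact h.symm
  -- (E3) norm-one eigenvalues from ellipticity
  have hu1 : ∀ i, conjLocal L (IsCMField.complexConj L) v (u i) * u i = 1 :=
    forall_conjLocal_mul_eq_one_of_not_exists_conj_glDiagonal L v w hw hP hu hell
  -- (E4) compact centralisers, both classes
  haveI : CompactSpace (Subgroup.centralizer ({γH.1} : Set ((cmDatum L 2 (Matrix.of fun i j : Fin 2 => if i.val + j.val + 1 = 2 then (1 : L) else 0)).Local v))) :=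
    compactSpace_centralizer_of_eigenframe_of_smul_eq L w hw (Matrix.of fun i j : Fin 2 => if i.val + j.val + 1 = 2 then (1 : L) else 0) (antidiagOne_isHermitian L 2) (by
      rw [Matrix.det_fin_two]; simp [Matrix.of_apply]) γH.1 hP hu hu1
  have hcpt : ∀ δ : (cmDatum L 2 (Matrix.of fun i j : Fin 2 => if i.val + j.val + 1 = 2 then (1 : L) else 0)).Local v, IsStablyConj (conjLocal L (IsCMField.complexConj L) v) ((adelicForm L 2 (Matrix.of fun i j : Fin 2 => if i.val + j.val + 1 = 2 then (1 : L) else 0)).map (adeleToLocal L v)) γH.1 δ →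
      CompactSpace (Subgroup.centralizer ({δ} : Set ((cmDatum L 2 (Matrix.of fun i j : Fin 2 => if i.val + j.val + 1 = 2 then (1 : L) else 0)).Local v))) := fun δ hst => by
    obtain ⟨x, hx⟩ := isConj_iff.1 hst
    have hx' : δ.val = x * γH.1.val * x⁻¹ := hx.symm
    have hQ : δ.val.val * (x * P).val = (x * P).val * diagonal u := by
      rw [hx', Units.val_mul, Units.val_mul, Units.val_mul, Matrix.mul_assoc (x.val * γH.1.val.val), ← Matrix.mul_assoc (x⁻¹).val,
        Units.inv_mul, Matrix.one_mul, Matrix.mul_assoc, hP, ← Matrix.mul_assoc]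
    exact compactSpace_centralizer_of_eigenframe_of_smul_eq L w hw (Matrix.of fun i j : Fin 2 => if i.val + j.val + 1 = 2 then (1 : L) else 0) (antidiagOne_isHermitian L 2) (by
      rw [Matrix.det_fin_two]; simp [Matrix.of_apply]) δ hQ hu hu1
  -- `G`-regularity of the second class
  have hreg' : ∀ δ : (cmDatum L 2 (Matrix.of fun i j : Fin 2 => if i.val + j.val + 1 = 2 then (1 : L) else 0)).Local v, IsStablyConj (conjLocal L (IsCMField.complexConj L) v) ((adelicForm L 2 (Matrix.of fun i j : Fin 2 => if i.val + j.val + 1 = 2 then (1 : L) else 0)).map (adeleToLocal L v)) γH.1 δ →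
      IsLocalGRegular L v (δ, γH.2) := fun δ hst =>
    isGRegular_of_isStablyConjH (conjLocal L (IsCMField.complexConj L) v)
      ((adelicForm L 2 (Matrix.of fun i j : Fin 2 => if i.val + j.val + 1 = 2 then (1 : L) else 0)).map (adeleToLocal L v)) ((adelicForm L 1 (Matrix.of fun i j : Fin 1 => if i.val + j.val + 1 = 1 then (1 : L) else 0)).map (adeleToLocal L v))
      ((adelicForm L 3 (Matrix.of fun i j : Fin 3 => if i.val + j.val + 1 = 3 then (1 : L) else 0)).map (adeleToLocal L v)) (h := endoForm_localForm L v) (a := γH) (a' := (δ, γH.2))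
      ⟨hst, IsStablyConj.refl _⟩ hreg
  -- `N` in the `valuation` currency: `u₀(w) − u₁(w) = α − γ`, `v_w(ϖ^N) = exp(−N)`
  have hN' : valuation (w.1.adicCompletion L) (u 0 w - u 1 w) = valuation (w.1.adicCompletion L) ((toPlace v w (GaloisRepresentations.HeckeCharacter.uniformizer ↥(maximalRealSubfield L) v : v.adicCompletion ↥(maximalRealSubfield L))) ^ N) := by
    rw [hu0, hu1w]
    refine (v_eq_iff_valuation_eq _ _).1 ?_
    rw [hN, map_pow, Liu2021.LemD1IndexedNonVacuityInertCofinite.valued_toPlace_uniformizer_of_isUnramifiedIn L v hv w, ← WithZero.exp_nsmul]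
    simp
  exact stableOrbitalIntegralRel_indicator_eq_phiH_of_eigenframe L v w hw νH hv hmH hνH γH.1 γH.2 hreg hP hu hu1 hN' hcpt hreg'

end Head

end Literature.NumberTheory.Automorphic.UnitaryGroup

end
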